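import Literature.NumberTheory.Transcendental.NesterenkoBricksPadic
import Literature.NumberTheory.Transcendental.TaylorCoeffPadicDiv
import HarnessLib

/-!
# Nesterenko's elementary bricks, II′: Zudilin's Lemmas 17–18 in divided-derivative form

Topic `Literature/NumberTheory/Transcendental`. `NesterenkoBricksPadic.lean` proves [Zudilin2004, Lemmas 17–18]
— the sharp `p`-adic orders of the Taylor coefficients of the polynomial brick `R(a,b;t)` and of the regularised
reciprocal brick `R(a,b;t)(t+k)` at `t = -k` — in the `IsDOrd` form (`TaylorCoeffPadic.lean`: bounds on
`ord_p f^{(j)}`), whose Leibniz rule loses nothing only for primes `p > N`. The application in the proof of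
[Zudilin2004, Lemma 19] needs the primes `√h₀ < p ≤ m_{q−r}` at orders up to `q − r − 1`, which may exceed `p`;
this file re-proves the two lemmas in the DIVIDED-derivative form `IsDOrdDiv` of `TaylorCoeffPadicDiv.lean`
(bounds on `ord_p (1/j!) f^{(j)}`, exactly the quantity of (7.4) and (7.7)), whose product rule is sharp for
every prime:

* `polyBrick_isDOrdDiv_count`, `polyBrick_isDOrdDiv` — **Lemma 17, (7.4)**: for `R(t) = R(a,b;t)`, `a = b + m`,
  `m < p²`, every integer `k`: `ord_p (1/j!)R^{(j)}(-k) ≥ -j + ⌊(a-1-k)/p⌋ - ⌊(b-1-k)/p⌋ - ⌊(a-b)/p⌋`;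
* `recipBrickReg_isDOrdDiv_count`, `recipBrickReg_isDOrdDiv` — **Lemma 18, (7.7)**: for the reciprocal brick,
  `a₀ ≤ a < b ≤ b₀`, `a₀ ≤ k < b₀`, `p² > b₀-a₀-1`:
  `ord_p (1/j!)(R(t)(t+k))^{(j)}|_{t=-k} ≥ -j + ⌊(b-a-1)/p⌋ - ⌊(k-a)/p⌋ - ⌊(b-1-k)/p⌋`.

The proofs are those of `NesterenkoBricksPadic.lean` with the factorwise lemmas `isDOrdDiv_add_const`,
`isDOrdDiv_inv_add_const` and the product rule `IsDOrdDiv.prod`; the exponent bookkeeping (number of multiples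
of `p` in an interval = difference of integer parts, Legendre for `m < p²`, (7.5)) is identical.
Everything here is PROVED (no named facts).

## References

* [Zudilin2004] W. Zudilin, *Arithmetic of linear forms involving odd zeta values*, J. Théor. Nombres Bordeaux
  16 (2004), 251–291 = arXiv:math/0206176, §7: (7.3), (7.5), Lemma 17 with (7.4), Lemma 18 with (7.7).
-/

noncomputable section

open Finset Filter Literature.Analysis.Calculus
open scoped Nat

namespace Literature.NumberTheory.Transcendental

/-! ### Lemma 17 -/

/-- **[Zudilin2004, Lemma 17]** (sharp `p`-adic order of the polynomial brick), divided-derivative count form: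
at `t = -k` the brick `R(t) = (t+b)⋯(t+b+m-1)/m!` has
`ord_p (1/j!)R^{(j)}(-k) ≥ -j + #{l < m : p ∣ b+l-k} - ord_p m!`. [cite: Zudilin2004, §7 Lemma 17] -/
theorem polyBrick_isDOrdDiv_count (p : ℕ) [hp : Fact p.Prime] (b : ℤ) (m : ℕ) (k : ℤ) (N : ℕ) :
    IsDOrdDiv p ((((range m).filter fun l : ℕ => (p : ℤ) ∣ b + l - k).card : ℤ) - padicValNat p m !)
      N (polyBrick b m) (-(k : ℚ)) := by
  have hfac := IsDOrdDiv.prod (p := p) (N := N) (x := (-(k : ℚ))) (range m)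
    (E := fun l : ℕ => if (p : ℤ) ∣ (b + l) - k then 1 else 0)
    (F := fun (l : ℕ) (t : ℚ) => t + ((b + l : ℤ) : ℚ))
    (fun l _ => isDOrdDiv_add_const p (b + l - k) (by push_cast; ring) N)
  have hconst : PadicOrdGe p (-(padicValNat p m ! : ℤ)) ((m ! : ℚ))⁻¹ := by
    refine Or.inr (le_of_eq ?_)
    rw [padicValRat.inv, padicValRat.of_nat]
  have h := hfac.const_mul hconst
  have hsum : ∑ l ∈ range m, (if (p : ℤ) ∣ b + l - k then (1 : ℤ) else 0)
      = (((range m).filter fun l : ℕ => (p : ℤ) ∣ b + l - k).card : ℤ) := by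
    rw [sum_boole]
  refine (h.mono (le_of_eq ?_)).congr (Eventually.of_forall fun t => ?_)
  · rw [hsum]; ring
  · show ((m ! : ℚ))⁻¹ * ∏ l ∈ range m, (t + ((b + l : ℤ) : ℚ)) = polyBrick b m t
    unfold polyBrick
    rw [div_eq_inv_mul]
    congr 1
    exact prod_congr rfl fun l _ => by push_cast; ring

/-- **[Zudilin2004, Lemma 17, (7.4)]**, divided-derivative form: for `R(t) = R(a,b;t) = (t+b)⋯(t+a-1)/(a-b)!`
with `a = b + m`, an integer `k`, and a prime `p` with `m < p²`,
`ord_p (1/j!)R^{(j)}(-k) ≥ -j + ⌊(a-1-k)/p⌋ - ⌊(b-1-k)/p⌋ - ⌊(a-b)/p⌋` for all `j` (integer parts = `Int.ediv`).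
[cite: Zudilin2004, §7 Lemma 17 (7.4)] -/
theorem polyBrick_isDOrdDiv (p : ℕ) [hp : Fact p.Prime] (b : ℤ) (m : ℕ) (hm : m < p ^ 2) (k : ℤ)
    (N : ℕ) :
    IsDOrdDiv p ((b + m - 1 - k) / p - (b - 1 - k) / p - (m : ℤ) / p) N (polyBrick b m) (-(k : ℚ)) := by
  have h := polyBrick_isDOrdDiv_count p b m k N
  have hp0 : (0 : ℤ) < p := by exact_mod_cast hp.out.pos
  have hcount := card_filter_dvd_range (b - k) m hp0
  have hcongr : ((range m).filter fun l : ℕ => (p : ℤ) ∣ b + l - k)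
      = (range m).filter fun l : ℕ => (p : ℤ) ∣ b - k + l := by
    refine filter_congr fun l _ => ?_
    rw [show b + l - k = b - k + l by ring]
  rw [hcongr, hcount] at h
  rw [padicValNat_factorial_of_lt_sq p m hm] at h
  refine h.mono (le_of_eq ?_)
  have e1 : b - k + m - 1 = b + m - 1 - k := by ring
  have e2 : b - k - 1 = b - 1 - k := by ring
  rw [e1, e2]
  push_cast
  ring

/-! ### Lemma 18 -/

/-- **[Zudilin2004, Lemma 18]**, divided-derivative count form: for the reciprocal brick `R = recipBrick a m`
and an integer `k` such that `ord_p (a+l-k) ≤ 1` whenever `l < m`, `a + l ≠ k` (true when `|a+l-k| < p²`), the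
regularised product `R(t)(t+k)` satisfies at `t = -k`:
`ord_p (1/j!)(R(t)(t+k))^{(j)} ≥ -j + ord_p (m-1)! - #{l < m : a+l ≠ k, p ∣ a+l-k} + [¬(a ≤ k < a+m)]`.
[cite: Zudilin2004, §7 Lemma 18] -/
theorem recipBrickReg_isDOrdDiv_count (p : ℕ) [hp : Fact p.Prime] (a : ℤ) (m : ℕ) (k : ℤ)
    (hv : ∀ l ∈ range m, a + (l : ℤ) ≠ k → padicValInt p (a + l - k) ≤ 1) (N : ℕ) :
    IsDOrdDiv p ((padicValNat p (m - 1)! : ℤ)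
        - ((((range m).filter fun l : ℕ => a + (l : ℤ) ≠ k).filter
            fun l : ℕ => (p : ℤ) ∣ a + l - k).card : ℤ)
        + (if a ≤ k ∧ k < a + m then 0 else 1))
      N (recipBrickReg a m k) (-(k : ℚ)) := by
  set S := (range m).filter fun l : ℕ => a + (l : ℤ) ≠ k with hS
  have hfac := IsDOrdDiv.prod (p := p) (N := N) (x := (-(k : ℚ))) S
    (E := fun l : ℕ => if (p : ℤ) ∣ (a + l) - k then -1 else 0)
    (F := fun (l : ℕ) (t : ℚ) => (t + ((a + (l : ℤ) : ℤ) : ℚ))⁻¹) (fun l hl => by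
      have hl' := (mem_filter.1 hl)
      exact isDOrdDiv_inv_add_const p (a + l - k) (by push_cast; ring) (sub_ne_zero.2 hl'.2)
        (hv l hl'.1 hl'.2) N)
  have hconst : PadicOrdGe p (padicValNat p (m - 1)! : ℤ) (((m - 1)! : ℚ)) := by
    refine Or.inr (le_of_eq ?_)
    rw [padicValRat.of_nat]
  have hlast : IsDOrdDiv p (if a ≤ k ∧ k < a + m then 0 else 1) N
      (fun t : ℚ => if a ≤ k ∧ k < a + m then (1 : ℚ) else t + k) (-(k : ℚ)) := by
    split_ifs with hk
    · exact IsDOrdDiv.one N _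
    · have := isDOrdDiv_add_const p (c := (k : ℚ)) (x := -(k : ℚ)) 0 (by push_cast; ring) N
      simpa using this
  have h := (hfac.const_mul hconst).mul hlast
  have hsum : ∑ l ∈ S, (if (p : ℤ) ∣ a + l - k then (-1 : ℤ) else 0)
      = -((S.filter fun l : ℕ => (p : ℤ) ∣ a + l - k).card : ℤ) := by
    have hneg : ∀ l : ℕ, (if (p : ℤ) ∣ a + l - k then (-1 : ℤ) else 0)
        = -(if (p : ℤ) ∣ a + l - k then (1 : ℤ) else 0) := fun l => by
      split_ifs <;> simp
    simp_rw [hneg, sum_neg_distrib, sum_boole]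
  refine (h.mono (le_of_eq ?_)).congr (Eventually.of_forall fun t => ?_)
  · rw [hsum]; ring
  · simp only [recipBrickReg, hS]

/-- **[Zudilin2004, Lemma 18, (7.7)]**, divided-derivative form: let `a, b = a + m, a₀, b₀` be integers with
`a₀ ≤ a < b ≤ b₀`, let `k` be an integer with `a₀ ≤ k < b₀`, and let `p` be a prime with `p² > b₀ - a₀ - 1`.
Then for the reciprocal brick `R(t) = R(a,b;t)`,
`ord_p (1/j!)(R(t)(t+k))^{(j)}|_{t=-k} ≥ -j + ⌊(b-a-1)/p⌋ - ⌊(k-a)/p⌋ - ⌊(b-1-k)/p⌋` for all `j`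
(integer parts = `Int.ediv`). [cite: Zudilin2004, §7 Lemma 18 (7.7)] -/
theorem recipBrickReg_isDOrdDiv (p : ℕ) [hp : Fact p.Prime] {a₀ b₀ a : ℤ} {m : ℕ} (hm : 1 ≤ m)
    (ha : a₀ ≤ a) (hb : a + m ≤ b₀) {k : ℤ} (hk₁ : a₀ ≤ k) (hk₂ : k < b₀)
    (hp2 : b₀ - a₀ - 1 < (p : ℤ) ^ 2) (N : ℕ) :
    IsDOrdDiv p (((m : ℤ) - 1) / p - (k - a) / p - (a + m - 1 - k) / p) N
      (recipBrickReg a m k) (-(k : ℚ)) := by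
  have hp0 : (0 : ℤ) < p := by exact_mod_cast hp.out.pos
  -- hypothesis of the count form: `ord_p (a+l-k) ≤ 1` since `0 < |a+l-k| < p²`
  have hv : ∀ l ∈ range m, a + (l : ℤ) ≠ k → padicValInt p (a + l - k) ≤ 1 := by
    intro l hl hne
    have hl' := mem_range.1 hl
    refine padicValInt_le_one_of_abs_lt_sq p (sub_ne_zero.2 hne) ?_
    rw [abs_lt]; constructor <;> nlinarith
  have h := recipBrickReg_isDOrdDiv_count p a m k hv N
  -- count of multiples of `p` among `a-k, …, a+m-1-k`
  have hcount := card_filter_dvd_range (a - k) m hp0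
  set T := (range m).filter fun l : ℕ => (p : ℤ) ∣ a - k + l with hT
  set S' := ((range m).filter fun l : ℕ => a + (l : ℤ) ≠ k).filter
    fun l : ℕ => (p : ℤ) ∣ a + l - k with hS'
  -- `#S' + [a ≤ k < a+m] = #T`
  have hST : (S'.card : ℤ) + (if a ≤ k ∧ k < a + m then 1 else 0) = T.card := by
    by_cases hkr : a ≤ k ∧ k < a + m
    · rw [if_pos hkr]
      have hl0 : (k - a).toNat ∈ T := by
        rw [hT, mem_filter, mem_range]
        refine ⟨by omega, ⟨0, by omega⟩⟩
      have hS'eq : S' = T.erase (k - a).toNat := by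
        ext l
        simp only [hS', hT, mem_filter, mem_range, mem_erase]
        constructor
        · rintro ⟨⟨hl, hne⟩, hd⟩
          refine ⟨by omega, hl, by rw [show a - k + l = a + l - k by ring]; exact hd⟩
        · rintro ⟨hne, hl, hd⟩
          refine ⟨⟨hl, by omega⟩, by rw [show a + l - k = a - k + l by ring]; exact hd⟩
      rw [hS'eq, card_erase_of_mem hl0]
      have : 1 ≤ T.card := card_pos.2 ⟨_, hl0⟩
      omega
    · rw [if_neg hkr, add_zero]
      have hS'eq : S' = T := by
        ext l
        simp only [hS', hT, mem_filter, mem_range]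
        constructor
        · rintro ⟨⟨hl, -⟩, hd⟩
          exact ⟨hl, by rw [show a - k + l = a + l - k by ring]; exact hd⟩
        · rintro ⟨hl, hd⟩
          exact ⟨⟨hl, by omega⟩, by rw [show a + l - k = a - k + l by ring]; exact hd⟩
      rw [hS'eq]
  refine h.mono ?_
  have hleg : ((m - 1) / p : ℕ) ≤ padicValNat p (m - 1)! := div_le_padicValNat_factorial p (m - 1)
  have hleg' : (((m : ℤ) - 1) / p) ≤ (padicValNat p (m - 1)! : ℤ) := by
    have : (((m - 1 : ℕ) : ℤ) / (p : ℤ)) = (((m - 1) / p : ℕ) : ℤ) := by simp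
    rw [show ((m : ℤ) - 1) = ((m - 1 : ℕ) : ℤ) by omega, this]
    exact_mod_cast hleg
  have h75 := Int.neg_sub_one_ediv_eq (k - a) hp0
  have e1 : -(k - a) - 1 = a - k - 1 := by ring
  rw [e1] at h75
  have e2 : a - k + m - 1 = a + m - 1 - k := by ring
  rw [e2] at hcount
  -- assemble
  have key : (S'.card : ℤ) - (if a ≤ k ∧ k < a + m then 0 else 1)
      = (a + m - 1 - k) / p + (k - a) / p := by
    have := hST
    rw [hcount, h75] at this
    split_ifs at this ⊢ with hkr <;> linarith
  linarith

end Literature.NumberTheory.Transcendental
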